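import Summits.BirchSwinnertonDyer.Rank1Residual.GaloisImage.WildThreeAdicTower
import Literature.NumberTheory.EllipticCurves.KleinFrickeLevelNine
import HarnessLib

/-!
# The level-`3` Hauptmodul `S = A₁(P)³/A₃(P)` at a non-canonical `3`-torsion point: weight `0`,
# and `v(S)³ = v(3)^m` when `v₃(j − 1728) = m ∈ {1, …, 4}`
# (cell `b2b-bsdres`, team n1011, seat p02 gen 5 — row T-b11-F4, file F4c-H3 'Hauptmodul route,
# curve side: the valuation of the level-3 Hauptmodul'; no reduction theory, valuations in `ℚ̄`)

HONEST FRAMING (cell `b2b-bsdres`, run/shared/lean/b2b/bsd-rank1-residual/, verbatim in every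
file): the goal of the cell is to DELETE the COMBINATION-SHAPED residual classes of the
Birch–Swinnerton-Dyer formula for ALL analytic-rank `≤ 1` elliptic curves over `ℚ` — "full BSD
formula for every rank `≤ 1` curve in class `C`" assembled STRICTLY from published theorems — so
that the rank-`≤ 1` remainder becomes exactly the CONSTRUCTION-SHAPED classes, which are TYPED
(missing-input `Prop`s), NOT attempted. This is not "finishing BSD". Team n1011 (N10 / N11):
research route; no claim beyond the stated classes; labels UNCHANGED; nothing is booked. Theorems
only (no definition, no named fact).

## What this file proves

`A₁(P) = a₁ + 2λ_P`, `A₃(P) = y − ȳ` are the tangent-normalised coefficients of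
`Literature/…/KleinFrickeLevelNine` (`WeierstrassCurve.tgA₁`, `tgA₃`); for `P = T` of order `3`,
`S(T) = A₁(T)³/A₃(T) = τ₃(T)` is the level-`3` Hauptmodul of `(E, ⟨T⟩)`
(`KleinFrickeLevelTwentySeven.level_nine_three_smul`: `S − 27 = η(η² + 9η + 27)` for the level-`9`
Hauptmodul `η` of any `C ⊂ E[9]` with `3C = ⟨T⟩`).  Let `v` be the place of `ℚ̄` over `3`, `t = v(3)`.

* `tgA₁_toXY_eq_mul`, `tgA₃_toXY_eq_mul`, **`tgA₁_pow_three_div_tgA₃_toXY`** (§1) — under ANY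
  admissible change of variables `(u, r, s, t)`: `A₁ ↦ u⁻¹A₁`, `A₃ ↦ u⁻³A₃`, so `S = A₁³/A₃` is
  invariant (weight `0`; the tree had the `u = 1` case `tgA₁_toXY`).
* `valuation_hauptmodul_three_of_shape` (§2) — on the normal shape `y² = x³ + A x² + x` with
  `v(A)⁶ = t^m`, `1 ≤ m ≤ 4`, at a point `(ξ, η)` with `v(ξ)¹⁸ t^m = 1` (the NON-CANONICAL
  `3`-torsion abscissa of `WildThreeTorsionValuation.exists_isRoot_Ψ₃_wild`):
  `A₃ = 2η`, `A₁ = (3ξ² + 2Aξ + 1)/η` with `3ξ² + 2Aξ + 1` a unit and `v(η)² = v(ξ)³`, hence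
  **`v(S)³ = t^m`**.
* **`exists_nineTorsion_hauptmodul_three_valuation`** (§3) — for `E/ℚ` with
  `v₃(j − 1728) = m ∈ {1, 2, 3, 4}` there is a geometric point `Q` with `9Q = O` and
  `3Q = T = (x₃, y₃) ≠ O` such that `v(A₁(T)³/A₃(T))³ = t^m` (on `E ⊗ ℚ̄`; normal shape by
  `WildThreeAdicTower.exists_variableChange_normalShape`, transport by §1).

For the EXOTIC core (`m = 3`) this is `v(S) = v(3)`: the hypothesis `hvS` of the curve-free core
`HauptmodulNineValuationFour.valuation_hauptmodul_nine_invariant_pow_nine` (`v₃(j) = 4`: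
`v(9θ²/(θ³ − 6)² − 1)⁹ = v(3)` for `θ³ = S`).  Nothing booked.

References: [SilvermanAEC2009] III.1 Table 3.1; [Maier2006] §5.
-/

noncomputable section

set_option maxRecDepth 10000

open scoped Classical

open Polynomial WeierstrassCurve

namespace Summit.BirchSwinnertonDyer.Rank1Residual.GaloisImage

open Literature.NumberTheory.EllipticCurves Literature.NumberTheory.GaloisRepresentations
  Rat.HeightOneSpectrum

/-! ### §1 `A₁³/A₃` has weight `0` -/

section Weight

variable {F : Type*} [Field F] {V : WeierstrassCurve F}

/-- `A₁ = a₁ + 2λ_P` has weight `1`: `A₁' = u⁻¹ A₁` under `(u, r, s, t)` (`λ' = u⁻¹(λ − s)`,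
`a₁' = u⁻¹(a₁ + 2s)`). [cite: SilvermanAEC2009, III.1 Table 3.1] -/
theorem tgA₁_toXY_eq_mul (C : VariableChange F) {x y : F} (h : V.toAffine.Equation x y)
    (hy : y ≠ V.toAffine.negY x y) :
    (C • V).tgA₁ (C.toX x) (C.toY x y) = (C.u⁻¹ : Fˣ) * V.tgA₁ x y := by
  rw [tgA₁, tgA₁, VariableChange.slope_toXY V C h h (fun hh => hy hh.2), variableChange_a₁]
  ring

/-- `A₃ = y − ȳ` has weight `3`: `A₃' = u⁻³ A₃` under `(u, r, s, t)`.
[cite: SilvermanAEC2009, III.1 Table 3.1] -/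
theorem tgA₃_toXY_eq_mul (C : VariableChange F) (x y : F) :
    (C • V).tgA₃ (C.toX x) (C.toY x y) = (C.u⁻¹ : Fˣ) ^ 3 * V.tgA₃ x y := by
  rw [tgA₃, tgA₃, VariableChange.negY_toXY, VariableChange.toY_def, VariableChange.toY_def]
  ring

/-- **`S = A₁³/A₃` has weight `0`**: it is unchanged by every admissible change of variables.
[cite: SilvermanAEC2009, III.1 Table 3.1] -/
theorem tgA₁_pow_three_div_tgA₃_toXY (C : VariableChange F) {x y : F}
    (h : V.toAffine.Equation x y) (hy : y ≠ V.toAffine.negY x y) :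
    (C • V).tgA₁ (C.toX x) (C.toY x y) ^ 3 / (C • V).tgA₃ (C.toX x) (C.toY x y) =
      V.tgA₁ x y ^ 3 / V.tgA₃ x y := by
  rw [tgA₁_toXY_eq_mul C h hy, tgA₃_toXY_eq_mul C x y, mul_pow,
    mul_div_mul_left _ _ (pow_ne_zero 3 (C.u⁻¹).ne_zero)]

end Weight

/-! ### §2 The Hauptmodul on the normal shape at a non-canonical `3`-torsion point -/

section Shape

variable {E : WeierstrassCurve (AlgebraicClosure ℚ)}

/-- **`v(A₁(P)³/A₃(P))³ = v(3)^m` on the shape.**  On `y² = x³ + A x² + x` with `v(A)⁶ = t^m`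
(`t = v(3)`, `1 ≤ m ≤ 4`), at `P = (ξ, η)` with `v(ξ)¹⁸ t^m = 1`: `P ≠ −P`, and
`S = A₁³/A₃ = (3ξ² + 2Aξ + 1)³/(2η⁴)` has `v(S)³ = t^m` (`3ξ² + 2Aξ + 1` is a unit since
`v(3ξ²)⁹ = t^{9−m} < 1`, `v(2Aξ)¹⁸ = t^{2m} < 1`; `v(η)² = v(ξ)³`). [folklore] -/
theorem valuation_hauptmodul_three_of_shape (h1 : E.a₁ = 0) (h3 : E.a₃ = 0) (h4 : E.a₄ = 1)
    (h6 : E.a₆ = 0) {m : ℕ} (hm1 : 1 ≤ m) (hm4 : m ≤ 4)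
    (hα : (placeOver 3).valuation E.a₂ ^ 6 = (placeOver 3).valuation (3 : AlgebraicClosure ℚ) ^ m)
    {ξ η : AlgebraicClosure ℚ}
    (hξ : (placeOver 3).valuation ξ ^ 18 * (placeOver 3).valuation (3 : AlgebraicClosure ℚ) ^ m = 1)
    (heq : E.toAffine.Equation ξ η) :
    η ≠ E.toAffine.negY ξ η ∧
      (placeOver 3).valuation (E.tgA₁ ξ η ^ 3 / E.tgA₃ ξ η) ^ 3 =
        (placeOver 3).valuation (3 : AlgebraicClosure ℚ) ^ m := by
  set v := (placeOver 3).valuation with hv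
  set t := v (3 : AlgebraicClosure ℚ) with ht
  have ht1 : t < 1 := valuation_three_lt_one
  have ht0 : t ≠ 0 := valuation_three_ne_zero
  set s := v ξ with hs
  set α := v E.a₂ with hαdef
  have htm1 : t ^ m < 1 := pow_lt_one₀ zero_le ht1 (by omega)
  have htm0 : t ^ m ≠ 0 := pow_ne_zero _ ht0
  have hs18 : s ^ 18 = (t ^ m)⁻¹ := eq_inv_of_mul_eq_one_left hξ
  have hs1 : 1 < s := by
    by_contra hle
    rw [not_lt] at hle
    have h' : s ^ 18 ≤ 1 := pow_le_one₀ zero_le hle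
    rw [hs18, inv_le_one₀ (zero_lt_iff.mpr htm0)] at h'
    exact absurd h' (not_le.mpr htm1)
  have hs0' : 0 < s := zero_lt_one.trans hs1
  have hs0 : s ≠ 0 := ne_of_gt hs0'
  have hα1 : α < 1 := by
    by_contra hle
    rw [not_lt] at hle
    have h' : 1 ≤ α ^ 6 := one_le_pow₀ hle
    rw [hα] at h'
    exact absurd h' (not_le.mpr htm1)
  -- the curve equation
  have hη2 : η ^ 2 = ξ ^ 3 + E.a₂ * ξ ^ 2 + ξ := by
    rw [Affine.equation_iff, h1, h3, h4, h6] at heq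
    linear_combination heq
  -- `v(η)² = s³`
  have hs3 : s * s ^ 2 = s ^ 3 := by rw [← pow_succ']
  have hvη : v η ^ 2 = s ^ 3 := by
    rw [← map_pow, hη2]
    have hlt : v (E.a₂ * ξ ^ 2 + ξ) < v (ξ ^ 3) := by
      refine (Valuation.map_add _ _ _).trans_lt (max_lt ?_ ?_)
      · rw [map_mul, map_pow, map_pow]
        calc α * s ^ 2 < 1 * s ^ 2 := mul_lt_mul_of_pos_right hα1 (pow_pos hs0' 2)
          _ < s * s ^ 2 := mul_lt_mul_of_pos_right hs1 (pow_pos hs0' 2)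
          _ = s ^ 3 := hs3
      · rw [map_pow]
        calc s = s * 1 := (mul_one s).symm
          _ < s * s ^ 2 := mul_lt_mul_of_pos_left (one_lt_pow₀ hs1 two_ne_zero) hs0'
          _ = s ^ 3 := hs3
    rw [add_assoc, Valuation.map_add_eq_of_lt_left _ hlt, map_pow]
  -- `N = 3ξ² + 2Aξ + 1` is a unit
  have h2 : v (2 : AlgebraicClosure ℚ) = 1 := by
    simpa using valuation_intCast_eq_one_of_not_dvd (n := 2) (by decide)
  obtain ⟨k, hk⟩ : ∃ k, 9 = k + m ∧ 1 ≤ k := ⟨9 - m, by omega, by omega⟩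
  have hN : v (3 * ξ ^ 2 + 2 * E.a₂ * ξ + 1) = 1 := by
    have hlt : v (3 * ξ ^ 2 + 2 * E.a₂ * ξ) < v (1 : AlgebraicClosure ℚ) := by
      rw [map_one]
      refine (Valuation.map_add _ _ _).trans_lt (max_lt ?_ ?_)
      · rw [map_mul, map_pow]
        by_contra hle
        rw [not_lt] at hle
        have h9 : 1 ≤ (t * s ^ 2) ^ 9 := one_le_pow₀ hle
        have h' : (t * s ^ 2) ^ 9 = t ^ k := by
          rw [mul_pow, ← pow_mul, hs18, hk.1, pow_add, mul_assoc, mul_inv_cancel₀ htm0, mul_one]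
        rw [h'] at h9
        exact absurd h9 (not_le.mpr (pow_lt_one₀ zero_le ht1 (by omega)))
      · rw [map_mul, map_mul, h2, one_mul]
        by_contra hle
        rw [not_lt] at hle
        have h18 : 1 ≤ (α * s) ^ 18 := one_le_pow₀ hle
        have hα18 : α ^ 18 = (t ^ m) ^ 3 := by rw [show (18 : ℕ) = 6 * 3 from rfl, pow_mul, hα]
        have h' : (α * s) ^ 18 = (t ^ m) ^ 2 := by
          rw [mul_pow, hα18, hs18, pow_succ, mul_assoc, mul_inv_cancel₀ htm0, mul_one]
        rw [h'] at h18
        exact absurd h18 (not_le.mpr (pow_lt_one₀ zero_le htm1 two_ne_zero))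
    rw [show (3 * ξ ^ 2 + 2 * E.a₂ * ξ + 1 : AlgebraicClosure ℚ) = 1 + (3 * ξ ^ 2 + 2 * E.a₂ * ξ)
      by ring, Valuation.map_add_eq_of_lt_left _ hlt, map_one]
  -- `η ≠ 0`, `P ≠ −P`
  have hη0 : η ≠ 0 := by
    intro h0
    have h' : v η ^ 2 = 0 := by rw [h0, map_zero, zero_pow two_ne_zero]
    rw [hvη] at h'
    exact pow_ne_zero 3 hs0 h'
  have hneg : E.toAffine.negY ξ η = -η := by rw [Affine.negY, h1, h3]; ring
  have hy : η ≠ E.toAffine.negY ξ η := by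
    rw [hneg]
    intro h
    apply hη0
    have h' : (2 : AlgebraicClosure ℚ) * η = 0 := by linear_combination h
    exact (mul_eq_zero.mp h').resolve_left two_ne_zero
  refine ⟨hy, ?_⟩
  -- `A₃ = 2η`, `A₁ = N/η`, `S · 2η⁴ = N³`
  have hA3 : E.tgA₃ ξ η = 2 * η := by rw [tgA₃, hneg]; ring
  have hA1 : E.tgA₁ ξ η = (3 * ξ ^ 2 + 2 * E.a₂ * ξ + 1) / η := by
    rw [tgA₁, Affine.slope_of_Y_ne rfl hy, hneg, h1, h4, show η - -η = 2 * η by ring]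
    field_simp
    ring
  have hS : E.tgA₁ ξ η ^ 3 / E.tgA₃ ξ η * (2 * η ^ 4) = (3 * ξ ^ 2 + 2 * E.a₂ * ξ + 1) ^ 3 := by
    rw [hA1, hA3]
    field_simp
  have hvS := congrArg v hS
  rw [map_mul, map_mul, map_pow, map_pow, hN, h2, one_pow, one_mul] at hvS
  have hη12 : v η ^ 12 = (t ^ m)⁻¹ := by
    rw [show (12 : ℕ) = 2 * 6 from rfl, pow_mul, hvη, ← pow_mul, hs18]
  calc v (E.tgA₁ ξ η ^ 3 / E.tgA₃ ξ η) ^ 3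
      = v (E.tgA₁ ξ η ^ 3 / E.tgA₃ ξ η) ^ 3 * (v η ^ 12 * t ^ m) := by
        rw [hη12, inv_mul_cancel₀ htm0, mul_one]
    _ = (v (E.tgA₁ ξ η ^ 3 / E.tgA₃ ξ η) * v η ^ 4) ^ 3 * t ^ m := by
        rw [mul_pow, ← pow_mul, mul_assoc]
    _ = t ^ m := by rw [hvS, one_pow, one_mul]

end Shape

/-! ### §3 On `E/ℚ`: a `9`-torsion point `Q` with `v(S(3Q))³ = v(3)^m` -/

section Main

variable (W : WeierstrassCurve ℚ) [W.IsElliptic]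

/-- **The valuation of the level-`3` Hauptmodul at a non-canonical `3`-torsion point of `E/ℚ`.**
For `E/ℚ` with `1 ≤ v₃(j − 1728) = m ≤ 4` there are a geometric point `Q` with `9Q = O` and an
affine `T = 3Q = (x₃, y₃)` (so `Q` has order `9`) with `v(A₁(T)³/A₃(T))³ = v(3)^m` on `E ⊗ ℚ̄`
(normal shape, the non-canonical `3`-torsion abscissa, division by `3` in `E(ℚ̄)`, weight-`0`
transport of §1).  For `m = 3`: `v(S(T)) = v(3)`. [folklore] -/
theorem exists_nineTorsion_hauptmodul_three_valuation {m : ℕ} (hm1 : 1 ≤ m) (hm4 : m ≤ 4)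
    (hj : padicValRat 3 (W.j - 1728) = m) :
    ∃ (Q : W.geomPoints) (x₃ y₃ : AlgebraicClosure ℚ)
      (h₃ : (W.map (algebraMap ℚ (AlgebraicClosure ℚ))).toAffine.Nonsingular x₃ y₃),
      (9 : ℤ) • Q = 0 ∧
      (3 : ℤ) • Q = (Affine.Point.some x₃ y₃ h₃ :
        (W.map (algebraMap ℚ (AlgebraicClosure ℚ))).toAffine.Point) ∧
      y₃ ≠ (W.map (algebraMap ℚ (AlgebraicClosure ℚ))).toAffine.negY x₃ y₃ ∧
      (placeOver 3).valuation
          ((W.map (algebraMap ℚ (AlgebraicClosure ℚ))).tgA₁ x₃ y₃ ^ 3 /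
            (W.map (algebraMap ℚ (AlgebraicClosure ℚ))).tgA₃ x₃ y₃) ^ 3 =
        (placeOver 3).valuation (3 : AlgebraicClosure ℚ) ^ m := by
  set v := (placeOver 3).valuation with hv
  set t := v (3 : AlgebraicClosure ℚ) with ht
  -- normal shape
  obtain ⟨C, h1, h3, h4, h6, -, -⟩ :=
    exists_variableChange_normalShape (W.map (algebraMap ℚ (AlgebraicClosure ℚ)))
  set E'' := C • W.map (algebraMap ℚ (AlgebraicClosure ℚ)) with hE''
  have hq0 : W.j - 1728 ≠ 0 := by
    intro h0; rw [h0, padicValRat.zero] at hj; exact_mod_cast (show (m : ℤ) ≠ 0 by omega) hj.symm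
  have hjK : v (E''.j - 1728) = t ^ m := by
    have h' : E''.j - 1728 = algebraMap ℚ (AlgebraicClosure ℚ) (W.j - 1728) := by
      rw [show E''.j = (W.map (algebraMap ℚ (AlgebraicClosure ℚ))).j from variableChange_j _ _,
        map_j, map_sub, map_ofNat]
    rw [h']
    exact valuation_ratCast_eq_pow_of_padicValRat hq0 hj
  obtain ⟨-, -, -, hα⟩ :=
    valuation_a₂_of_shape_of_j (W := E'') h1 h3 h4 h6 hm1 (hm4.trans (by norm_num)) hjK
  -- a non-canonical `3`-torsion point `(ξ, η)` of the shape
  obtain ⟨ξ, hξroot, hξ⟩ := exists_isRoot_Ψ₃_wild (W := E'') h1 h3 h4 h6 hm1 hm4 hα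
  obtain ⟨η, hη⟩ :=
    IsAlgClosed.exists_pow_nat_eq (ξ ^ 3 + E''.a₂ * ξ ^ 2 + ξ) (by norm_num : 0 < 2)
  have hPeq : E''.toAffine.Equation ξ η := by
    rw [Affine.equation_iff, h1, h3, h4, h6, hη]; ring
  have hPns : E''.toAffine.Nonsingular ξ η := (Affine.equation_iff_nonsingular ..).mp hPeq
  have hP3 : (3 : ℤ) • (Affine.Point.some ξ η hPns : E''.toAffine.Point) = 0 := by
    refine (zsmul_some_eq_zero_iff_eval_ΨSq E'' hPns 3).mpr ?_
    rw [ΨSq_three, eval_pow, hξroot.eq_zero, zero_pow two_ne_zero]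
  obtain ⟨hy, hval⟩ := valuation_hauptmodul_three_of_shape h1 h3 h4 h6 hm1 hm4 hα hξ hPeq
  -- divide by `3` on `W ⊗ ℚ̄`
  set φ := VariableChange.pointEquiv (W.map (algebraMap ℚ (AlgebraicClosure ℚ))) C with hφ
  set P₀ : (W.map (algebraMap ℚ (AlgebraicClosure ℚ))).toAffine.Point :=
    φ.symm (Affine.Point.some ξ η hPns) with hP₀
  have hP₀3 : (3 : ℤ) • P₀ = 0 := by rw [hP₀, ← map_zsmul, hP3, map_zero]
  obtain ⟨Q₀, hQ₀3⟩ : ∃ Q₀ : (W.map (algebraMap ℚ (AlgebraicClosure ℚ))).toAffine.Point,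
      (3 : ℤ) • Q₀ = P₀ :=
    W.zsmul_geomPoints_surjective_holds (n := 3) (by norm_num) P₀
  have hQ₀9 : (9 : ℤ) • Q₀ = 0 := by
    rw [show (9 : ℤ) = 3 * 3 by norm_num, mul_smul, hQ₀3, hP₀3]
  have hP₀eq : P₀ = φ.symm (Affine.Point.some ξ η hPns) := rfl
  rw [hφ, VariableChange.pointEquiv_symm_apply, VariableChange.pointInv_some] at hP₀eq
  -- transport of `S` along `C`: `S_W(C⁻¹(ξ, η)) = S_{E''}(ξ, η)`
  have hWeq : (W.map (algebraMap ℚ (AlgebraicClosure ℚ))).toAffine.Equation (C.ofX ξ) (C.ofY ξ η) :=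
    ((VariableChange.nonsingular_ofXY_iff _ C ξ η).mpr hPns).left
  have hWy : C.ofY ξ η ≠
      (W.map (algebraMap ℚ (AlgebraicClosure ℚ))).toAffine.negY (C.ofX ξ) (C.ofY ξ η) := by
    intro hyy
    apply hy
    have e := VariableChange.negY_toXY (W.map (algebraMap ℚ (AlgebraicClosure ℚ))) C
      (C.ofX ξ) (C.ofY ξ η)
    rw [VariableChange.toX_ofX, VariableChange.toY_ofY, ← hyy, VariableChange.toY_ofY] at e
    rw [hE'']
    exact e.symm
  have htr := tgA₁_pow_three_div_tgA₃_toXY C hWeq hWy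
  rw [VariableChange.toX_ofX, VariableChange.toY_ofY, ← hE''] at htr
  refine ⟨Q₀, C.ofX ξ, C.ofY ξ η, _, hQ₀9, hQ₀3.trans hP₀eq, hWy, ?_⟩
  rw [← htr]
  exact hval

end Main

end Summit.BirchSwinnertonDyer.Rank1Residual.GaloisImage
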